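import Mathlib
import Summits.Ventures.HodgeRepro.Tier4.Common.AdelicRTF
import Summits.Ventures.HodgeRepro.Tier4.Line4.TorusProduct
import Summits.Ventures.HodgeRepro.Tier4.Line4.InnerSplit

/-!
# Tier4/Line4/ArchFactorMismatch — C-L4-D3COEFF, the kernel half of the archimedean factor: CHARACTER ORTHOGONALITY
on the compact torus — the `γ₀`-term's archimedean factor `∫_{T_∞} χ(a) I_∞(a) da` VANISHES unless the character `χ`
matches the torus weight of the archimedean test function

Blind re-derivation cell `pub-hodge-repro`, Tier 4 (README §9–§10), seat t4-L1-p5 (prover, gen 4; cut C-L4-D3COEFF,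
lead (R-8) S14747; kernel shape S14811 (2); paper proofs/t4/L4/D3COEFF-t4-L1-p5.md §5).  Target tree path
`lean/Summits/Ventures/HodgeRepro/Tier4/Line4/ArchFactorMismatch.lean`.  Mathlib + the tree's `innerInf`
(InnerSplit p696434) and `torusInf` (TorusProduct p695935); no printed input.

WHAT IS PROVED.  The archimedean factor of the `γ₀`-term, in the tree's own vocabulary (Integ-Concat-v2 Part 9's
`harch`): `A := ∫ a : T_∞, χ(a) · I_∞(a) dν_∞` with `I_∞(a) = ∫ a′ : T′_∞, conj χ′(a′) · F_∞(a⁻¹ γ₀,∞ a′) dν′_∞`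
(`innerInf`).  If the archimedean test function `F_∞` is LEFT-EQUIVARIANT under an element `κ` of `T_∞` —
`F_∞(κ⁻¹ x) = c · F_∞(x)` for every `x` (for the weight-3 coefficient `D3coeff` and `κ` in the local torus at `w₀`,
`c = (weightAt q w₀ 0 κ⁻¹)⁻¹ ^ 3`: the `T_{w₀}`-weight `(−3, 0)`) — then, the torus being abelian, `a ↦ χ(a) I_∞(a)`
transforms under the left translation by `κ` by the scalar `χ(κ) · c`, and the left invariance of the Haar measure
`ν_∞` forces `A = χ(κ) c · A`: so **`A = 0` unless `χ(κ) · c = 1`** (`integral_eq_zero_of_mul_left_eq_smul`,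
`archFactor_eq_zero_of_left_equivariant`).  The same with `T′_∞`, `χ′` and right equivariance
(`archFactor_eq_zero_of_right_equivariant'`).  This is the NECESSARY matching condition of L4-MATH §15.1 («`_he = ±3`»):
the displayed `harch ≠ 0` of the chain is satisfiable only when the corner characters restricted to the local tori at
`w₀` are the weights of the coefficient.  The SUFFICIENT direction (the value of `A` under the matching) needs the
place-product `T_∞ = ∏_w T_w` — not in the tree; it stays displayed.

Commutativity of the torus `T` is a DISPLAYED hypothesis `hcomm` of the left form (generic `W`; the right form needs
none); on the row planes of LINE L4 it is L4-p1's `torusT_mul_comm` (TorusComm p673925), consumed by name.  Nothing here says anything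
about the status of the Hodge conjecture for CM abelian varieties, which is NOT proved (HC_CM is NOT proved by anyone
in this repository).
-/

set_option autoImplicit false

noncomputable section

namespace Summit.Ventures.HodgeRepro.Tier4.Line4

open Summit.Ventures.HodgeRepro.Tier4.Common Summit.Ventures.HodgeRepro.Tier4.Line1 MeasureTheory NumberField

open scoped ComplexConjugate

section Generic

/-- **character orthogonality, the one-line form**: a function on a group that transforms under the left translation
by `κ` by a scalar `c ≠ 1` has integral `0` for every left-invariant measure (`∫ h = ∫ h(κ ·) = c ∫ h`). -/
theorem integral_eq_zero_of_mul_left_eq_smul {T : Type*} [Group T] [MeasurableSpace T] [MeasurableMul T]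
    (ν : Measure T) [ν.IsMulLeftInvariant] (h : T → ℂ) (κ : T) (c : ℂ) (hc : c ≠ 1)
    (hκ : ∀ a, h (κ * a) = c * h a) : ∫ a, h a ∂ν = 0 := by
  have h1 : ∫ a, h (κ * a) ∂ν = ∫ a, h a ∂ν := integral_mul_left_eq_self h κ
  have h2 : ∫ a, h (κ * a) ∂ν = c * ∫ a, h a ∂ν := by
    simp_rw [hκ]
    exact integral_const_mul c h
  have h3 : (c - 1) * ∫ a, h a ∂ν = 0 := by rw [sub_mul, one_mul, ← h2, h1, sub_self]
  exact (mul_eq_zero.1 h3).resolve_left (sub_ne_zero.2 hc)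

/-- the right-translation twin, for a right-invariant measure. -/
theorem integral_eq_zero_of_mul_right_eq_smul {T : Type*} [Group T] [MeasurableSpace T] [MeasurableMul T]
    (ν : Measure T) [ν.IsMulRightInvariant] (h : T → ℂ) (κ : T) (c : ℂ) (hc : c ≠ 1)
    (hκ : ∀ a, h (a * κ) = c * h a) : ∫ a, h a ∂ν = 0 := by
  have h1 : ∫ a, h (a * κ) ∂ν = ∫ a, h a ∂ν := integral_mul_right_eq_self h κ
  have h2 : ∫ a, h (a * κ) ∂ν = c * ∫ a, h a ∂ν := by
    simp_rw [hκ]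
    exact integral_const_mul c h
  have h3 : (c - 1) * ∫ a, h a ∂ν = 0 := by rw [sub_mul, one_mul, ← h2, h1, sub_self]
  exact (mul_eq_zero.1 h3).resolve_left (sub_ne_zero.2 hc)

end Generic

section Arch

variable {k : Type} [Field k] [NumberField k] (W : PlaneData k) [MeasurableSpace (GA W)] [BorelSpace (GA W)]
  (R : RTFData W)

omit [BorelSpace (GA W)] in
/-- **the inner archimedean integral is left-equivariant** when the test function is: for `κ ∈ T_∞` with
`F_∞(κ⁻¹ x) = c · F_∞(x)` and an abelian torus, `I_∞(κ a) = c · I_∞(a)`. -/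
theorem innerInf_mul_left_of_equivariant (hcomm : ∀ s t : torusT W, s * t = t * s) (Finf : GA W → ℂ) (γ₀ : GA W)
    (νinf' : Measure (torusInf' W)) (κ : torusInf W) (c : ℂ)
    (hfin : ∀ x : GA W, Finf ((((κ : torusT W) : GA W))⁻¹ * x) = c * Finf x) (a : torusInf W) :
    innerInf W R Finf γ₀ νinf' (κ * a) = c * innerInf W R Finf γ₀ νinf' a := by
  unfold innerInf
  rw [← integral_const_mul]
  refine integral_congr_ae (Filter.Eventually.of_forall fun a' => ?_)
  have hswap : ((((κ * a : torusInf W) : torusT W) : GA W))⁻¹ =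
      (((κ : torusT W) : GA W))⁻¹ * (((a : torusT W) : GA W))⁻¹ := by
    rw [Subgroup.coe_mul, hcomm (κ : torusT W) (a : torusT W), Subgroup.coe_mul, mul_inv_rev]
  have harg : ((((κ * a : torusInf W) : torusT W) : GA W))⁻¹ * GA.ofInfPart W γ₀ * (((a' : torusT' W) : GA W)) =
      (((κ : torusT W) : GA W))⁻¹ * ((((a : torusT W) : GA W))⁻¹ * GA.ofInfPart W γ₀ * (((a' : torusT' W) : GA W))) := by
    rw [hswap]
    group
  show conj (R.chi' (a' : torusT' W)) * Finf _ = c * (conj (R.chi' (a' : torusT' W)) * Finf _)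
  rw [harg, hfin]
  ring

/-- **THE NECESSARY MATCHING CONDITION (left form)**: if `F_∞` is left-equivariant under `κ ∈ T_∞` with scalar `c`
and `χ(κ) · c ≠ 1`, the archimedean factor `∫_{T_∞} χ(a) I_∞(a) dν_∞` of the `γ₀`-term (the `harch` of the chain)
is `0`. -/
theorem archFactor_eq_zero_of_left_equivariant (hcomm : ∀ s t : torusT W, s * t = t * s) (Finf : GA W → ℂ)
    (γ₀ : GA W) (νinf : Measure (torusInf W)) [νinf.IsMulLeftInvariant] (νinf' : Measure (torusInf' W))
    (κ : torusInf W) (c : ℂ) (hfin : ∀ x : GA W, Finf ((((κ : torusT W) : GA W))⁻¹ * x) = c * Finf x)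
    (hc : R.chi κ * c ≠ 1) :
    ∫ a : torusInf W, R.chi a * innerInf W R Finf γ₀ νinf' a ∂νinf = 0 := by
  refine integral_eq_zero_of_mul_left_eq_smul νinf _ κ (R.chi κ * c) hc fun a => ?_
  rw [innerInf_mul_left_of_equivariant W R hcomm Finf γ₀ νinf' κ c hfin a, Subgroup.coe_mul, R.chi_mul]
  ring

/-- **the inner archimedean integral vanishes under a mismatched right equivariance of the test function**: for
`κ′ ∈ T′_∞` with `F_∞(x κ′) = c′ · F_∞(x)` and a right-invariant `ν′_∞`, `I_∞(a) = conj χ′(κ′) c′ · I_∞(a)` — so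
`I_∞ = 0` identically unless `conj χ′(κ′) · c′ = 1` (no commutativity needed: `κ′` sits at the right end). -/
theorem innerInf_eq_zero_of_right_equivariant' (Finf : GA W → ℂ) (γ₀ : GA W) (νinf' : Measure (torusInf' W))
    [νinf'.IsMulRightInvariant] (κ' : torusInf' W) (c' : ℂ)
    (hfin : ∀ x : GA W, Finf (x * (((κ' : torusT' W) : GA W))) = c' * Finf x)
    (hc : conj (R.chi' κ') * c' ≠ 1) (a : torusInf W) : innerInf W R Finf γ₀ νinf' a = 0 := by
  unfold innerInf
  refine integral_eq_zero_of_mul_right_eq_smul νinf' _ κ' (conj (R.chi' κ') * c') hc fun a' => ?_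
  have hcoe : (((a' * κ' : torusInf' W) : torusT' W) : GA W) =
      (((a' : torusT' W) : GA W)) * (((κ' : torusT' W) : GA W)) := by
    rw [Subgroup.coe_mul, Subgroup.coe_mul]
  have hchi : R.chi' ((a' * κ' : torusInf' W) : torusT' W) = R.chi' a' * R.chi' κ' := by
    rw [Subgroup.coe_mul, R.chi'_mul]
  rw [hchi, hcoe, ← mul_assoc, hfin, map_mul]
  ring

/-- **THE NECESSARY MATCHING CONDITION (right form)**: right equivariance of `F_∞` under `κ′ ∈ T′_∞` with
`conj χ′(κ′) · c′ ≠ 1` kills the archimedean factor. -/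
theorem archFactor_eq_zero_of_right_equivariant' (Finf : GA W → ℂ) (γ₀ : GA W) (νinf : Measure (torusInf W))
    (νinf' : Measure (torusInf' W)) [νinf'.IsMulRightInvariant] (κ' : torusInf' W) (c' : ℂ)
    (hfin : ∀ x : GA W, Finf (x * (((κ' : torusT' W) : GA W))) = c' * Finf x)
    (hc : conj (R.chi' κ') * c' ≠ 1) :
    ∫ a : torusInf W, R.chi a * innerInf W R Finf γ₀ νinf' a ∂νinf = 0 := by
  simp [innerInf_eq_zero_of_right_equivariant' W R Finf γ₀ νinf' κ' c' hfin hc]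

end Arch

end Summit.Ventures.HodgeRepro.Tier4.Line4

end
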